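import Summits.CriticalPhenomena.PercolationContinuityZ3.Theorems.SahiLiebSahiContinuumKernel
import Summits.CriticalPhenomena.PercolationContinuityZ3.Theorems.SahiLiebSahiContinuumReal

/-!
# Conditionally increasing laws on `ℝ²` are Sahi-positive of every order (bounded measurable families)

Companion of `SahiLiebSahiContinuumKernel.lean` (CIS laws on the unit square) and `SahiLiebSahiContinuumReal.lean`
(product measures on `ℝ^d`), cell `prim-sahi`, typer, generation 9 (`--supports stmt-CriticalPhenomena-4575`).

The two devices are combined: the standard construction `(u, v) ↦ (Q_{μ₁}(u), Q_{κ(Q_{μ₁} u)}(v))` with REAL-valued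
quantile transforms is monotone only on the open square `(0,1)²`, so the pulled-back family is extended monotonically
to the boundary of `Q_2` (a Lebesgue-null set) before Lieb–Sahi's Theorem 3.7 is applied.  Proved:

* `msahiE_map_nonneg_of_monotoneOn_interior` — the general transfer lemma: `LiebSahiContinuum d n ⇒ E_n ≥ 0` under
  `Q_* λ_d` for every measurable `Q : Q_d → Ω` that is monotone ON THE INTERIOR `(0,1)^d`, for bounded nonnegative
  monotone measurable families on `Ω`;
* `RealKernelQuantile.rkq κ (a, v) = Q_{κ a}(v)` (`v ∈ (0,1)`; `0` at the endpoints) for a Markov kernel `κ : α → ℝ`: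
  jointly measurable, pushes `μ ⊗ λ` to `μ ⊗ₘ κ` (`map_prod_rkq`), monotone on the interior when `κ` is
  stochastically increasing (`rkq_mono`); `RealQuantile.rq_mono_measure` (stochastic order ⇒ quantile order);
* **`msahiE_compProd_real_nonneg`** — UNCONDITIONALLY: for every probability measure `μ₁` on `ℝ`, every stochastically
  increasing Markov kernel `κ : ℝ → ℝ` (`a ≤ b ⇒ κ_b((−∞,t]) ≤ κ_a((−∞,t])`), every `n` and all bounded nonnegative
  monotone increasing measurable `f_i : ℝ² → ℝ`: `E_n(f_0,…,f_{n−1}) ≥ 0` under `μ₁ ⊗ₘ κ`; disintegrated form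
  `msahiE_nonneg_of_cis_real` (`μ = μ.fst ⊗ₘ κ`).  This contains `msahiE_prod_real_nonneg_of_monotone` (constant kernel)
  and `msahiE_bivariateGaussian_nonneg` (the regression kernel `x ↦ N(a x + c, v)`, `a ≥ 0`), and is the `ℝ²` form of
  `msahiE_compProd_unitSquare_nonneg` [Belzunce–Martínez-Riquelme–Mulero 2016, §1.3.1 (standard construction),
  §1.3.4 (CIS); the `E_n` consequence is this work].
-/

noncomputable section

namespace Summit.CriticalPhenomena.PercolationContinuityZ3.Theorems

open MeasureTheory ProbabilityTheory Set Filter Topology Literature.Combinatorics.Sahi2008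
open scoped unitInterval

variable {d n : ℕ}

/-! ### Maps of the cube that are monotone on the interior -/

/-- Almost every point of the cube has no coordinate equal to `0` or `1` (plumbing). [folklore] -/
private theorem ae_forall_ne_zero_one :
    ∀ᵐ u : Fin d → I ∂(volume : Measure (Fin d → I)), ∀ j, u j ≠ 0 ∧ u j ≠ 1 := by
  refine eventually_all.2 fun j => ?_
  filter_upwards [Measure.ae_eval_ne (fun _ : Fin d => (volume : Measure I)) j 0,
    Measure.ae_eval_ne (fun _ : Fin d => (volume : Measure I)) j 1] with u hu0 hu1
  exact ⟨hu0, hu1⟩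

/-- A point of `[0,1]` which is neither endpoint is interior (plumbing). [folklore] -/
private theorem mem_Ioo_of_ne {w : I} (h0 : w ≠ 0) (h1 : w ≠ 1) : (w : ℝ) ∈ Ioo 0 1 := by
  by_contra hnot
  rcases RealQuantile.eq_zero_or_eq_one_of_not_mem_Ioo hnot with h | h
  · exact h0 h
  · exact h1 h

/-- **The transfer lemma for maps monotone on the interior.**  If `LiebSahiContinuum d n` holds, `Q : Q_d → Ω` is
measurable and monotone on the interior `(0,1)^d` of the cube, then every bounded nonnegative monotone measurable
family on `Ω` has `E_n ≥ 0` under the image measure `Q_* λ_d`.  (Pull back along `Q` and extend to the faces: `0`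
where some coordinate is `0`, the bound `M` where some coordinate is `1`; the extension is monotone on `Q_d` and equals
the pull-back a.e., so all joint moments agree.) [this work] -/
theorem msahiE_map_nonneg_of_monotoneOn_interior (h : LiebSahiContinuum d n) {Ω : Type*} [MeasurableSpace Ω]
    [Preorder Ω] {Q : (Fin d → I) → Ω} (hQm : Measurable Q)
    (hQ : ∀ u v : Fin d → I, (∀ j, ((u j : I) : ℝ) ∈ Ioo 0 1) → (∀ j, ((v j : I) : ℝ) ∈ Ioo 0 1) → u ≤ v →
      Q u ≤ Q v)
    (f : Fin n → Ω → ℝ) (hfm : ∀ i, Measurable (f i)) (hf0 : ∀ i x, 0 ≤ f i x) {M : ℝ}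
    (hfM : ∀ i x, f i x ≤ M) (hmono : ∀ i, Monotone (f i)) :
    0 ≤ msahiE ((volume : Measure (Fin d → I)).map Q) n f := by
  classical
  have hmp : MeasurePreserving Q volume ((volume : Measure (Fin d → I)).map Q) := ⟨hQm, rfl⟩
  rw [← msahiE_comp_measurePreserving_of_measurable hmp n f hfm]
  set g : Fin n → (Fin d → I) → ℝ := fun i u =>
    if ∃ j, u j = 0 then 0 else if ∃ j, u j = 1 then M else f i (Q u) with hg
  have hg_eq : ∀ i (u : Fin d → I), (∀ j, u j ≠ 0 ∧ u j ≠ 1) → g i u = f i (Q u) := by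
    intro i u hu
    have h0 : ¬ ∃ j, u j = 0 := fun ⟨j, hj⟩ => (hu j).1 hj
    have h1 : ¬ ∃ j, u j = 1 := fun ⟨j, hj⟩ => (hu j).2 hj
    simp only [hg, h0, h1, if_false]
  have hmom : msahiE (volume : Measure (Fin d → I)) n (fun i => f i ∘ Q) = msahiE volume n g := by
    refine msahiE_congr_of_moments _ _ _ _ fun S => integral_congr_ae ?_
    filter_upwards [ae_forall_ne_zero_one (d := d)] with u hu
    simp only [Finset.prod_apply, Function.comp_apply, hg_eq _ u hu]
  rw [hmom]
  have hz : ∀ w : I, w ≤ 0 → w = 0 := fun w hw => le_antisymm hw w.2.1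
  have ho : ∀ w : I, 1 ≤ w → w = 1 := fun w hw => le_antisymm w.2.2 hw
  refine liebSahiContinuum_iff_mSahiPositive.1 h g (fun i u => ?_) fun i u v huv => ?_
  · simp only [hg]
    split_ifs
    · exact le_rfl
    · exact (hf0 i (Q u)).trans (hfM i _)
    · exact hf0 i _
  · show g i u ≤ g i v
    simp only [hg]
    by_cases hu0 : ∃ j, u j = 0
    · rw [if_pos hu0]
      split_ifs
      · exact le_rfl
      · exact (hf0 i (Q u)).trans (hfM i _)
      · exact hf0 i _
    · rw [if_neg hu0]
      have hv0 : ¬ ∃ j, v j = 0 := fun ⟨j, hj⟩ => hu0 ⟨j, hz (u j) (hj ▸ huv j)⟩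
      rw [if_neg hv0]
      by_cases hu1 : ∃ j, u j = 1
      · obtain ⟨j, hj⟩ := hu1
        have hv1 : ∃ j, v j = 1 := ⟨j, ho (v j) (hj ▸ huv j)⟩
        rw [if_pos ⟨j, hj⟩, if_pos hv1]
      · rw [if_neg hu1]
        by_cases hv1 : ∃ j, v j = 1
        · rw [if_pos hv1]
          exact hfM i _
        · rw [if_neg hv1]
          have hint : ∀ (w : Fin d → I), (¬ ∃ j, w j = 0) → (¬ ∃ j, w j = 1) →
              ∀ j, ((w j : I) : ℝ) ∈ Ioo 0 1 :=
            fun w h0 h1 j => mem_Ioo_of_ne (fun h' => h0 ⟨j, h'⟩) (fun h' => h1 ⟨j, h'⟩)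
          exact hmono i (hQ u v (hint u hu0 hu1) (hint v hv0 hv1) huv)

/-! ### The real-valued quantile transform of a kernel `α → ℝ` -/

namespace RealQuantile

/-- **Stochastic monotonicity of the real quantile transform** on `(0,1)`: if `ν((−∞,t]) ≤ μ((−∞,t])` for all
`t` then `Q_μ(u) ≤ Q_ν(u)`. [folklore] -/
theorem rq_mono_measure (μ ν : Measure ℝ) [IsProbabilityMeasure μ] [IsProbabilityMeasure ν]
    (h : ∀ t : ℝ, ν (Set.Iic t) ≤ μ (Set.Iic t)) {u : ℝ} (hu0 : 0 < u) (hu1 : u < 1) : rq μ u ≤ rq ν u := by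
  rw [rq_le_iff μ hu0 hu1]
  calc u ≤ cdf ν (rq ν u) := le_cdf_rq ν hu1
    _ ≤ cdf μ (rq ν u) := by
      rw [cdf_eq_real, cdf_eq_real]
      exact ENNReal.toReal_mono (measure_ne_top _ _) (h _)

end RealQuantile

namespace RealKernelQuantile

variable {α : Type*} [MeasurableSpace α] (κ : Kernel α ℝ)

/-- **The real kernel quantile transform** `(a, v) ↦ Q_{κ a}(v)` for `v ∈ (0,1)` (and `0` at the two endpoints,
a null set). [folklore] -/
def rkq (p : α × I) : ℝ := if ((p.2 : I) : ℝ) ∈ Ioo (0 : ℝ) 1 then RealQuantile.rq (κ p.1) p.2 else 0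

/-- The value on the interior. [folklore] -/
theorem rkq_apply_of_mem (a : α) {v : I} (hv : (v : ℝ) ∈ Ioo 0 1) :
    rkq κ (a, v) = RealQuantile.rq (κ a) v := if_pos hv

/-- The (junk) value at the endpoints. [folklore] -/
theorem rkq_apply_of_not_mem (a : α) {v : I} (hv : (v : ℝ) ∉ Ioo 0 1) : rkq κ (a, v) = 0 := if_neg hv

/-- **Joint measurability**: `{rkq ≤ t} = {(a,v) : v ∈ (0,1), v ≤ κ_a((−∞,t])} ∪ {v ∉ (0,1), 0 ≤ t}`. [folklore] -/
theorem measurable_rkq [IsMarkovKernel κ] : Measurable (rkq κ) := by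
  refine measurable_of_Iic fun t => ?_
  have hset : rkq κ ⁻¹' Set.Iic t =
      ({p : α × I | ((p.2 : I) : ℝ) ∈ Ioo 0 1} ∩ {p : α × I | ((p.2 : I) : ℝ) ≤ (κ p.1).real (Set.Iic t)}) ∪
        ({p : α × I | ((p.2 : I) : ℝ) ∉ Ioo 0 1} ∩ {_p : α × I | 0 ≤ t}) := by
    ext ⟨a, v⟩
    simp only [Set.mem_preimage, Set.mem_Iic, Set.mem_union, Set.mem_inter_iff, Set.mem_setOf_eq]
    by_cases hv : (v : ℝ) ∈ Ioo 0 1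
    · rw [rkq_apply_of_mem κ a hv, RealQuantile.rq_le_iff (κ a) hv.1 hv.2, cdf_eq_real]
      constructor
      · exact fun h => Or.inl ⟨hv, h⟩
      · rintro (⟨-, h⟩ | ⟨h, -⟩)
        · exact h
        · exact absurd hv h
    · rw [rkq_apply_of_not_mem κ a hv]
      constructor
      · exact fun h => Or.inr ⟨hv, h⟩
      · rintro (⟨h, -⟩ | ⟨-, h⟩)
        · exact absurd h hv
        · exact h
  rw [hset]
  have hcoe : Measurable fun p : α × I => ((p.2 : I) : ℝ) := measurable_subtype_coe.comp measurable_snd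
  refine MeasurableSet.union ((measurableSet_Ioo.preimage hcoe).inter ?_)
    ((measurableSet_Ioo.preimage hcoe).compl.inter (MeasurableSet.const _))
  exact measurableSet_le hcoe ((Kernel.measurable_coe κ measurableSet_Iic).comp measurable_fst).ennreal_toReal

/-- The fibre maps are measurable. [folklore] -/
theorem measurable_rkq_mk [IsMarkovKernel κ] (a : α) : Measurable fun v : I => rkq κ (a, v) :=
  (measurable_rkq κ).comp (measurable_const.prodMk measurable_id)

/-- On each fibre the transform pushes Lebesgue measure of `[0,1]` to `κ a` (it agrees a.e. with `rqI (κ a)`).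
[folklore] -/
theorem map_rkq_mk [IsMarkovKernel κ] (a : α) : (volume : Measure I).map (fun v : I => rkq κ (a, v)) = κ a := by
  have h0 : ∀ᵐ v : I ∂volume, v ≠ 0 := by
    rw [ae_iff]
    simp only [ne_eq, not_not, setOf_eq_eq_singleton, measure_singleton]
  have h1 : ∀ᵐ v : I ∂volume, v ≠ 1 := by
    rw [ae_iff]
    simp only [ne_eq, not_not, setOf_eq_eq_singleton, measure_singleton]
  have hae : (fun v : I => rkq κ (a, v)) =ᵐ[volume] RealQuantile.rqI (κ a) := by
    filter_upwards [h0, h1] with v hv0 hv1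
    rw [rkq_apply_of_mem κ a (mem_Ioo_of_ne hv0 hv1), RealQuantile.rqI_apply]
  rw [Measure.map_congr hae, RealQuantile.map_rqI_volume]

/-- **The real standard construction realises the composition-product**: `(a, v) ↦ (a, Q_{κ a}(v))` pushes
`μ ⊗ λ` forward to `μ ⊗ₘ κ`. [folklore] -/
theorem map_prod_rkq [IsMarkovKernel κ] (μ : Measure α) [SFinite μ] :
    (μ.prod (volume : Measure I)).map (fun p : α × I => (p.1, rkq κ p)) = μ ⊗ₘ κ := by
  have hm : Measurable fun p : α × I => (p.1, rkq κ p) := measurable_fst.prodMk (measurable_rkq κ)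
  ext s hs
  rw [Measure.map_apply hm hs, Measure.prod_apply (hm hs), Measure.compProd_apply hs]
  refine lintegral_congr fun a => ?_
  have hfib : Prod.mk a ⁻¹' ((fun p : α × I => (p.1, rkq κ p)) ⁻¹' s) =
      (fun v : I => rkq κ (a, v)) ⁻¹' (Prod.mk a ⁻¹' s) := rfl
  rw [hfib, ← Measure.map_apply (measurable_rkq_mk κ a) (hs.preimage measurable_prodMk_left), map_rkq_mk]

variable [Preorder α]

/-- **Monotonicity on the interior**: for a stochastically increasing kernel (`a ≤ b ⇒ κ_b((−∞,t]) ≤ κ_a((−∞,t])`)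
the transform is monotone in `(a, v)` as long as `v` stays in `(0,1)`. [folklore] -/
theorem rkq_mono [IsMarkovKernel κ] (hκ : ∀ ⦃a b : α⦄, a ≤ b → ∀ t : ℝ, κ b (Set.Iic t) ≤ κ a (Set.Iic t)) {a b : α}
    (hab : a ≤ b)
    {u v : I} (hu : (u : ℝ) ∈ Ioo 0 1) (hv : (v : ℝ) ∈ Ioo 0 1) (huv : u ≤ v) : rkq κ (a, u) ≤ rkq κ (b, v) := by
  rw [rkq_apply_of_mem κ a hu, rkq_apply_of_mem κ b hv]
  exact (RealQuantile.rq_mono (κ a) hu.1 (Subtype.coe_le_coe.2 huv) hv.2).trans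
    (RealQuantile.rq_mono_measure (κ a) (κ b) (hκ hab) hv.1 hv.2)

end RealKernelQuantile

/-! ### Unconditionally: conditionally increasing laws on `ℝ²` -/

/-- **Every conditionally increasing law on `ℝ²` is Sahi-positive of every order** (bounded measurable families):
for every probability measure `μ₁` on `ℝ`, every stochastically increasing Markov kernel `κ : ℝ → ℝ`
(`a ≤ b ⇒ κ_b((−∞,t]) ≤ κ_a((−∞,t])` for all `t`), every `n`, and all bounded nonnegative monotone increasing measurable
`f_0,…,f_{n−1} : ℝ² → ℝ`: `E_n(f_0,…,f_{n−1}) ≥ 0` under `μ₁ ⊗ₘ κ`.  Contains every product measure (constant kernel)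
and every bivariate Gaussian with nonnegative correlation (regression kernel). [this work] -/
theorem msahiE_compProd_real_nonneg (μ₁ : Measure ℝ) [IsProbabilityMeasure μ₁] (κ : Kernel ℝ ℝ)
    [IsMarkovKernel κ] (hκ : ∀ ⦃a b : ℝ⦄, a ≤ b → ∀ t : ℝ, κ b (Set.Iic t) ≤ κ a (Set.Iic t)) (n : ℕ)
    (f : Fin n → ℝ × ℝ → ℝ) (hfm : ∀ i, Measurable (f i)) (hf0 : ∀ i p, 0 ≤ f i p) {M : ℝ}
    (hfM : ∀ i p, f i p ≤ M) (hmono : ∀ i, Monotone (f i)) : 0 ≤ msahiE (μ₁ ⊗ₘ κ) n f := by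
  -- the standard construction on `I × I`, then along `Q_2 ≃ I × I`
  set Ψ : I × I → ℝ × ℝ := fun q =>
    (RealQuantile.rqI μ₁ q.1, RealKernelQuantile.rkq κ (RealQuantile.rqI μ₁ q.1, q.2)) with hΨ
  have hstep : Measurable fun p : ℝ × I => (p.1, RealKernelQuantile.rkq κ p) :=
    measurable_fst.prodMk (RealKernelQuantile.measurable_rkq κ)
  have hprod : Measurable (Prod.map (RealQuantile.rqI μ₁) (id : I → I)) :=
    (RealQuantile.measurable_rqI μ₁).prodMap measurable_id
  have hΨeq : Ψ = (fun p : ℝ × I => (p.1, RealKernelQuantile.rkq κ p)) ∘ Prod.map (RealQuantile.rqI μ₁) id := by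
    funext q; rfl
  have hΨm : Measurable Ψ := by rw [hΨeq]; exact hstep.comp hprod
  have hvol : ((volume : Measure I).prod (volume : Measure I)).map Ψ = μ₁ ⊗ₘ κ := by
    rw [hΨeq, ← Measure.map_map hstep hprod, ← Measure.map_prod_map _ _ (RealQuantile.measurable_rqI μ₁)
      measurable_id, Measure.map_id, RealQuantile.map_rqI_volume, RealKernelQuantile.map_prod_rkq]
  set e := (MeasurableEquiv.finTwoArrow : (Fin 2 → I) ≃ᵐ I × I) with he
  have hev : (volume : Measure (Fin 2 → I)).map e = (volume : Measure I).prod volume :=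
    (volume_preserving_finTwoArrow I).map_eq
  have hQ : (volume : Measure (Fin 2 → I)).map (Ψ ∘ e) = μ₁ ⊗ₘ κ := by
    rw [← Measure.map_map hΨm e.measurable, hev, hvol]
  rw [← hQ]
  refine msahiE_map_nonneg_of_monotoneOn_interior (liebSahiContinuum_two n) (hΨm.comp e.measurable) ?_ f hfm hf0
    hfM hmono
  intro u v hu hv huv
  have h0 : RealQuantile.rqI μ₁ (u 0) ≤ RealQuantile.rqI μ₁ (v 0) :=
    RealQuantile.rqI_mono_of_mem_Ioo μ₁ (hu 0) (hv 0) (huv 0)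
  change Ψ (u 0, u 1) ≤ Ψ (v 0, v 1)
  exact Prod.mk_le_mk.2 ⟨h0, RealKernelQuantile.rkq_mono κ hκ h0 (hu 1) (hv 1) (huv 1)⟩

/-- **CIS laws on `ℝ²`, disintegrated form**: a probability measure `μ` on `ℝ²` admitting a stochastically increasing
disintegration `μ = μ.fst ⊗ₘ κ` is Sahi-positive of every order for bounded measurable increasing families.
[this work] -/
theorem msahiE_nonneg_of_cis_real (μ : Measure (ℝ × ℝ)) [IsProbabilityMeasure μ] (κ : Kernel ℝ ℝ)
    [IsMarkovKernel κ] (hdis : μ.fst ⊗ₘ κ = μ)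
    (hκ : ∀ ⦃a b : ℝ⦄, a ≤ b → ∀ t : ℝ, κ b (Set.Iic t) ≤ κ a (Set.Iic t)) (n : ℕ) (f : Fin n → ℝ × ℝ → ℝ)
    (hfm : ∀ i, Measurable (f i)) (hf0 : ∀ i p, 0 ≤ f i p) {M : ℝ} (hfM : ∀ i p, f i p ≤ M)
    (hmono : ∀ i, Monotone (f i)) : 0 ≤ msahiE μ n f := by
  rw [← hdis]
  exact msahiE_compProd_real_nonneg μ.fst κ hκ n f hfm hf0 hfM hmono

/-- Consistency: the CONSTANT kernel gives back the product measures of `SahiLiebSahiContinuumReal.lean`. -/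
example (μ₁ μ₂ : Measure ℝ) [IsProbabilityMeasure μ₁] [IsProbabilityMeasure μ₂] (n : ℕ)
    (f : Fin n → ℝ × ℝ → ℝ) (hfm : ∀ i, Measurable (f i)) (hf0 : ∀ i p, 0 ≤ f i p) {M : ℝ}
    (hfM : ∀ i p, f i p ≤ M) (hmono : ∀ i, Monotone (f i)) : 0 ≤ msahiE (μ₁.prod μ₂) n f := by
  rw [← Measure.compProd_const]
  exact msahiE_compProd_real_nonneg μ₁ (Kernel.const ℝ μ₂) (fun a b _ t => le_rfl) n f hfm hf0 hfM hmono

end Summit.CriticalPhenomena.PercolationContinuityZ3.Theorems
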